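import Mathlib
import Literature.Analysis.FluidPDE.Tao2016AveragedNS.WeightedLatticeFlows
import Literature.Analysis.ODE.LinearComparison
import HarnessLib

/-!
# Tao 2016, §4: uniqueness of regular solutions of the NS-scaled viscous cascade lattice

T. Tao, *Finite time blowup for an averaged three-dimensional Navier–Stokes equation*, J. Amer. Math.
Soc. **29** (2016), §4 (the viscous equation before Thm. 4.2; the a priori weight (4.5)).  Two REGULAR
solutions (weighted bound `w_k|X_{i,k}| ≤ B` on the window, admissible weights) of the `ν`-viscous
lattice `∂ₜX_{i,k} = quadTerm_{i,k}(X) − ν(1+ε₀)^{2k}X_{i,k}` on `[0,s]` with the same initial state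
coincide on `[0,s]` (`ν ≥ 0`; the inviscid lattice is the case `ν = 0`).  Standard Grönwall/Picard
uniqueness (Teschl 2012, Thm. 2.2), organised through the damping-free Duhamel bound
`|g(t)| ≤ |g(a)| + (t − a) sup|q|` for `g' = q − κ g`, `κ ≥ 0`, on windows of length `1/(2K+1)`,
`K` the Lipschitz constant of the conjugated field on the ball of radius `B`.  Companion of
`ViscousLatticeFlows` (existence/continuation).  MODEL lattice ODEs only.
-/

noncomputable section

open Set Metric Filter Topology BoundedContinuousFunction

namespace Literature.Analysis.FluidPDE

namespace TaoCascade

variable {m : ℕ}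

/-- **Damping-free Duhamel bound on an interval.**  If `g' = q − κ g` within `[a,b]`, `κ ≥ 0` and
`|q| ≤ Q` there, then `|g(t)| ≤ |g(a)| + Q (t − a)` for `t ∈ [a,b]` (`e^{-κ(t-r)} ≤ 1` in the variation
of constants). [cite: Teschl2012, §3.4 (3.97) and Lemma 2.7 (Grönwall)] -/
theorem abs_le_of_forcing_on_Icc {g q : ℝ → ℝ} {a b κ Q : ℝ} (hκ : 0 ≤ κ)
    (hg : ∀ t ∈ Icc a b, HasDerivWithinAt g (q t - κ * g t) (Icc a b) t)
    (hq : ∀ t ∈ Icc a b, |q t| ≤ Q) : ∀ t ∈ Icc a b, |g t| ≤ |g a| + Q * (t - a) := by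
  intro t ht
  have hab : a ≤ b := ht.1.trans ht.2
  have hQ0 : 0 ≤ Q := (abs_nonneg _).trans (hq a ⟨le_rfl, hab⟩)
  have hgc : ContinuousOn g (Icc a b) := fun u hu => (hg u hu).continuousWithinAt
  have hg' : ∀ u ∈ Ico a b, HasDerivWithinAt g (q u - κ * g u) (Ici u) u := fun u hu =>
    (hg u (Ico_subset_Icc_self hu)).mono_of_mem_nhdsWithin
      (mem_of_superset (Icc_mem_nhdsGE hu.2) (Icc_subset_Icc hu.1 le_rfl))
  have hI1 : ∀ u, ∫ r in a..u, (-κ : ℝ) = -κ * (u - a) := fun u => by simp; ring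
  -- the forcing integral is at most `Q e^{κ(t-a)} (t-a)`
  have hI2 : ∀ (S : ℝ), |S| ≤ Q → |∫ r in a..t, S * Real.exp (-(∫ x in a..r, (-κ : ℝ)))| ≤
      Q * Real.exp (κ * (t - a)) * (t - a) := by
    intro S hS
    have h1 : ‖∫ r in a..t, S * Real.exp (-(∫ x in a..r, (-κ : ℝ)))‖ ≤
        Q * Real.exp (κ * (t - a)) * |t - a| := by
      refine intervalIntegral.norm_integral_le_of_norm_le_const fun r hr => ?_
      rw [uIoc_of_le ht.1] at hr
      rw [hI1, Real.norm_eq_abs, abs_mul, abs_of_pos (Real.exp_pos _)]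
      refine mul_le_mul hS (Real.exp_le_exp.2 ?_) (Real.exp_pos _).le hQ0
      nlinarith [hr.2]
    rwa [abs_of_nonneg (sub_nonneg.2 ht.1), Real.norm_eq_abs] at h1
  have hup := Literature.Analysis.ODE.le_linearComparison (A := fun _ => Q) (β := fun _ => -κ) hgc hg'
    continuousOn_const continuousOn_const (fun u hu => by
      have := (abs_le.1 (hq u (Ico_subset_Icc_self hu))).2; linarith) ht
  have hlo := Literature.Analysis.ODE.linearComparison_le (A := fun _ => -Q) (β := fun _ => -κ) hgc hg'
    continuousOn_const continuousOn_const (fun u hu => by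
      have := (abs_le.1 (hq u (Ico_subset_Icc_self hu))).1; linarith) ht
  rw [hI1] at hup hlo
  have hE : Real.exp (-κ * (t - a)) * Real.exp (κ * (t - a)) = 1 := by rw [← Real.exp_add]; simp
  have hEpos : 0 < Real.exp (-κ * (t - a)) := Real.exp_pos _
  have hEle : Real.exp (-κ * (t - a)) ≤ 1 := Real.exp_le_one_iff.2 (by nlinarith [ht.1])
  have hJp := hI2 Q (by rw [abs_of_nonneg hQ0])
  have hJm := hI2 (-Q) (by rw [abs_neg, abs_of_nonneg hQ0])
  set Jp := ∫ r in a..t, Q * Real.exp (-(∫ x in a..r, (-κ : ℝ))) with hJpd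
  set Jm := ∫ r in a..t, -Q * Real.exp (-(∫ x in a..r, (-κ : ℝ))) with hJmd
  have hg0 : |Real.exp (-κ * (t - a)) * g a| ≤ |g a| := by
    rw [abs_mul, abs_of_pos hEpos]; exact mul_le_of_le_one_left (abs_nonneg _) hEle
  have hJp' : Real.exp (-κ * (t - a)) * Jp ≤ Q * (t - a) := by
    calc Real.exp (-κ * (t - a)) * Jp ≤ Real.exp (-κ * (t - a)) * |Jp| :=
          mul_le_mul_of_nonneg_left (le_abs_self _) hEpos.le
      _ ≤ Real.exp (-κ * (t - a)) * (Q * Real.exp (κ * (t - a)) * (t - a)) :=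
          mul_le_mul_of_nonneg_left hJp hEpos.le
      _ = Q * (t - a) := by rw [show Real.exp (-κ * (t - a)) * (Q * Real.exp (κ * (t - a)) * (t - a))
          = Q * (t - a) * (Real.exp (-κ * (t - a)) * Real.exp (κ * (t - a))) by ring, hE, mul_one]
  have hJm' : -(Q * (t - a)) ≤ Real.exp (-κ * (t - a)) * Jm := by
    have h1 : -|Jm| ≤ Jm := neg_abs_le _
    calc -(Q * (t - a)) = -(Real.exp (-κ * (t - a)) * (Q * Real.exp (κ * (t - a)) * (t - a))) := by
          rw [show Real.exp (-κ * (t - a)) * (Q * Real.exp (κ * (t - a)) * (t - a))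
            = Q * (t - a) * (Real.exp (-κ * (t - a)) * Real.exp (κ * (t - a))) by ring, hE, mul_one]
      _ ≤ -(Real.exp (-κ * (t - a)) * |Jm|) := by
          exact neg_le_neg (mul_le_mul_of_nonneg_left hJm hEpos.le)
      _ ≤ Real.exp (-κ * (t - a)) * Jm := by nlinarith [h1, hEpos]
  have hga := abs_le.1 hg0
  rw [abs_le]
  constructor
  · have : Real.exp (-κ * (t - a)) * (g a + Jm) ≤ g t := hlo
    nlinarith [hga.1]
  · have : g t ≤ Real.exp (-κ * (t - a)) * (g a + Jp) := hup
    nlinarith [hga.2]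

/-- If `0 ≤ x ≤ c / 2^j` for every `j`, then `x = 0`. [folklore] -/
private theorem eq_zero_of_le_div_two_pow {x c : ℝ} (hx : 0 ≤ x) (h : ∀ j : ℕ, x ≤ c / 2 ^ j) :
    x = 0 := by
  by_contra hne
  have hxp : 0 < x := lt_of_le_of_ne hx (Ne.symm hne)
  obtain ⟨j, hj⟩ := pow_unbounded_of_one_lt (c / x) (by norm_num : (1 : ℝ) < 2)
  have h1 := h j
  rw [le_div_iff₀ (by positivity)] at h1
  rw [div_lt_iff₀ hxp] at hj
  linarith [mul_comm x ((2 : ℝ) ^ j)]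

/-- **Uniqueness of regular viscous flows.**  Let the weights be admissible
(`WeightRatiosLE ε₀ w A`), the structure constants bounded by `M_α`, `ν ≥ 0`.  Two solutions of the
`ν`-viscous lattice on `[0,s]` (derivatives within `[0,s]`) with the same state at time `0` and the
weighted a priori bound `w_k |X_{i,k}(t)| ≤ B` on `[0,s]` coincide on `[0,s]`.
[cite: Tao2016AveragedNS, §4 (the viscous equation before Thm. 4.2, Lemma 4.1 (4.5)); Teschl2012, Thm. 2.2 (uniqueness)] -/
theorem viscousFlow_unique {ε₀ ν A Mα B s : ℝ} {α : Fin m → Fin m → Fin m → ℤ × ℤ × ℤ → ℝ}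
    {w : ℤ → ℝ} (hε : 0 ≤ 1 + ε₀) (hw : WeightRatiosLE ε₀ w A) (hMα : 0 ≤ Mα)
    (hα : ∀ i₁ i₂ i₃ μ, |α i₁ i₂ i₃ μ| ≤ Mα) (hν : 0 ≤ ν) {X Y : Fin m → ℤ → ℝ → ℝ}
    (h0 : ∀ i k, X i k 0 = Y i k 0)
    (hXb : ∀ t ∈ Icc 0 s, ∀ i k, w k * |X i k t| ≤ B) (hYb : ∀ t ∈ Icc 0 s, ∀ i k, w k * |Y i k t| ≤ B)
    (hXd : ∀ i k, ∀ t ∈ Icc 0 s, HasDerivWithinAt (X i k)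
      (quadTerm ε₀ α X i k t - ν * (1 + ε₀) ^ ((2 : ℝ) * k) * X i k t) (Icc 0 s) t)
    (hYd : ∀ i k, ∀ t ∈ Icc 0 s, HasDerivWithinAt (Y i k)
      (quadTerm ε₀ α Y i k t - ν * (1 + ε₀) ^ ((2 : ℝ) * k) * Y i k t) (Icc 0 s) t) :
    ∀ t ∈ Icc 0 s, ∀ i k, X i k t = Y i k t := by
  obtain ⟨hwpos, hrat⟩ := id hw
  intro t₀ ht₀
  rcases isEmpty_or_nonempty (Fin m) with hm | hm
  · intro i; exact (hm.false i).elim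
  obtain ⟨i₁⟩ := hm
  have hB0 : 0 ≤ B := le_trans (mul_nonneg (hwpos 0).le (abs_nonneg _)) (hXb t₀ ht₀ i₁ 0)
  -- weighted slices on the window
  have hslice : ∀ (Z : Fin m → ℤ → ℝ → ℝ), (∀ t ∈ Icc 0 s, ∀ i k, w k * |Z i k t| ≤ B) →
      ∀ t ∈ Icc 0 s, ∃ T : Fin m × ℤ →ᵇ ℝ, ‖T‖ ≤ B ∧ ∀ i k, T (i, k) = w k * Z i k t := by
    intro Z hZ t ht
    have hH : ∀ p : Fin m × ℤ, ‖w p.2 * Z p.1 p.2 t‖ ≤ B := fun p => by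
      rw [Real.norm_eq_abs, abs_mul, abs_of_pos (hwpos p.2)]; exact hZ t ht p.1 p.2
    exact ⟨ofNormedAddCommGroupDiscrete (fun p : Fin m × ℤ => w p.2 * Z p.1 p.2 t) B hH,
      (norm_le hB0).2 hH, fun i k => rfl⟩
  set K : ℝ := 8 * (m : ℝ) ^ 2 * Mα * A * B with hK
  have hA : 0 ≤ A := le_trans (div_nonneg (Real.rpow_nonneg hε _) (hwpos 0).le) (hrat 0).1
  have hK0 : 0 ≤ K := by positivity
  -- the Lipschitz estimate of the weighted nonlinearity along the two flows
  have hlipq : ∀ t ∈ Icc 0 s, ∀ (M : ℝ), (∀ i k, |w k * (X i k t - Y i k t)| ≤ M) → ∀ i k,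
      |w k * (quadTerm ε₀ α X i k t - quadTerm ε₀ α Y i k t)| ≤ K * M := by
    intro t ht M hM i k
    obtain ⟨TX, hTXb, hTX⟩ := hslice X hXb t ht
    obtain ⟨TY, hTYb, hTY⟩ := hslice Y hYb t ht
    have hqX : weightedFieldFun ε₀ α w TX (i, k) = w k * quadTerm ε₀ α X i k t := by
      simp only [weightedFieldFun, quadTerm, hTX, mul_div_cancel_left₀ _ (hwpos _).ne']
    have hqY : weightedFieldFun ε₀ α w TY (i, k) = w k * quadTerm ε₀ α Y i k t := by
      simp only [weightedFieldFun, quadTerm, hTY, mul_div_cancel_left₀ _ (hwpos _).ne']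
    have hM0 : 0 ≤ M := (abs_nonneg _).trans (hM i k)
    have hdist : ‖TX - TY‖ ≤ M := (norm_le hM0).2 fun p => by
      obtain ⟨j, n⟩ := p
      rw [BoundedContinuousFunction.coe_sub, Pi.sub_apply, hTX, hTY, Real.norm_eq_abs, ← mul_sub]
      exact hM j n
    have h := abs_weightedFieldFun_sub_le hε hw hMα hα hB0 hTXb hTYb i k
    rw [hqX, hqY, ← mul_sub] at h
    exact h.trans (by rw [hK]; exact mul_le_mul_of_nonneg_left hdist (by positivity))
  -- the step length
  set τ : ℝ := 1 / (2 * K + 1) with hτ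
  have hτ0 : 0 < τ := by rw [hτ]; positivity
  have hKτ : K * τ ≤ 1 / 2 := by
    rw [hτ, mul_one_div, div_le_iff₀ (by positivity)]; linarith
  -- induction over windows of length `τ`
  have main : ∀ n : ℕ, ∀ t ∈ Icc 0 s, t ≤ n * τ → ∀ i k, X i k t = Y i k t := by
    intro n
    induction n with
    | zero =>
      intro t ht htn i k
      have : t = 0 := le_antisymm (by simpa using htn) ht.1
      rw [this, h0]
    | succ n ih =>
      intro t ht htn i k
      rcases le_or_gt t (n * τ) with hle | hle
      · exact ih t ht hle i k
      set a : ℝ := n * τ with ha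
      have ha0 : 0 ≤ a := by positivity
      have has : a ∈ Icc 0 s := ⟨ha0, hle.le.trans ht.2⟩
      have hta : t - a ≤ τ := by rw [ha]; push_cast at htn; linarith
      -- geometric improvement of the difference bound on `[a, t]`
      have hgeo : ∀ j : ℕ, ∀ r ∈ Icc a t, ∀ i k, |w k * (X i k r - Y i k r)| ≤ 2 * B / 2 ^ j := by
        intro j
        induction j with
        | zero =>
          intro r hr i k
          have hrs : r ∈ Icc 0 s := ⟨ha0.trans hr.1, hr.2.trans ht.2⟩
          rw [pow_zero, div_one, mul_sub, two_mul]
          refine (abs_sub _ _).trans (add_le_add ?_ ?_)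
          · rw [abs_mul, abs_of_pos (hwpos k)]; exact hXb r hrs i k
          · rw [abs_mul, abs_of_pos (hwpos k)]; exact hYb r hrs i k
        | succ j ihj =>
          intro r hr i k
          have hsub : Icc a t ⊆ Icc 0 s := fun u hu => ⟨ha0.trans hu.1, hu.2.trans ht.2⟩
          -- the weighted difference solves `g' = q − κ g` on `[a, t]`
          have hg : ∀ u ∈ Icc a t, HasDerivWithinAt (fun u => w k * (X i k u - Y i k u))
              (w k * (quadTerm ε₀ α X i k u - quadTerm ε₀ α Y i k u) -
                ν * (1 + ε₀) ^ ((2 : ℝ) * k) * (w k * (X i k u - Y i k u))) (Icc a t) u := by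
            intro u hu
            have h1 := ((hXd i k u (hsub hu)).sub (hYd i k u (hsub hu))).const_mul (w k)
            exact (h1.mono hsub).congr_deriv (by ring)
          have hqb : ∀ u ∈ Icc a t, |w k * (quadTerm ε₀ α X i k u - quadTerm ε₀ α Y i k u)| ≤
              K * (2 * B / 2 ^ j) := fun u hu => hlipq u (hsub hu) _ (ihj u hu) i k
          have h := abs_le_of_forcing_on_Icc (mul_nonneg hν (Real.rpow_nonneg hε _)) hg hqb r hr
          have hga : w k * (X i k a - Y i k a) = 0 := by
            rw [ih a has le_rfl i k, sub_self, mul_zero]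
          simp only [hga, abs_zero, zero_add] at h
          refine h.trans ?_
          have hra : r - a ≤ τ := by linarith [hr.2]
          have h2B : 0 ≤ 2 * B / 2 ^ j := by positivity
          calc K * (2 * B / 2 ^ j) * (r - a) ≤ K * (2 * B / 2 ^ j) * τ :=
                mul_le_mul_of_nonneg_left hra (mul_nonneg hK0 h2B)
            _ = (K * τ) * (2 * B / 2 ^ j) := by ring
            _ ≤ (1 / 2) * (2 * B / 2 ^ j) := mul_le_mul_of_nonneg_right hKτ h2B
            _ = 2 * B / 2 ^ (j + 1) := by rw [pow_succ]; ring
      have hzero := eq_zero_of_le_div_two_pow (abs_nonneg (w k * (X i k t - Y i k t)))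
        (fun j => hgeo j t ⟨hle.le, le_rfl⟩ i k)
      rw [abs_eq_zero, mul_eq_zero] at hzero
      rcases hzero with hzero | hzero
      · exact absurd hzero (hwpos k).ne'
      · linarith
  obtain ⟨n, hn⟩ := exists_nat_ge (t₀ / τ)
  exact main n t₀ ht₀ (by rw [div_le_iff₀ hτ0] at hn; linarith)

end TaoCascade

end Literature.Analysis.FluidPDE

end
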